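/-
Copyright (c) 2026. All rights reserved.
Released under Apache 2.0 license as described in the file LICENSE.
Authors: abc-iut cell, wave-2 seat abc-iut-L3-t11 (gen 2; row (β): the finite-level branch dictionary of a
Galois covering — one level).
-/
import Literature.AnabelianGeometry.SemiGraphs.TemperedCoveringsComponents
import Literature.AnabelianGeometry.SemiGraphs.OrbitGraphOrbits
import Literature.AnabelianGeometry.SemiGraphs.OrbitGraphMap
import Literature.AnabelianGeometry.SemiGraphs.UniversalCoveringOver
import HarnessLib

/-!
# [SemiAnbd] Def 2.2 (i) / Rmk 2.2.1 at ONE finite Galois level: fibres are torsors, vertices are cosets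

Mochizuki, *Semi-graphs of anabelioids*, Publ. RIMS **42** (2006) [MochizukiSemiAnbd2006], Definition 2.2 (i)
p. 23 ("the vertices of `𝒢'` that lie over `v` [are] the connected components of `S_v`"; branches over `b` at
`v'` ↔ double cosets) and Remark 2.2.1 p. 24 (the images of `Π_v`, `Π_b` are the stabilisers of the vertex /
branch), read at ONE connected finite étale Galois covering `S` of `𝒢` in the local presentation
(`TemperedCoverings.lean`: `S_v` a `Π_v`-set, `S_e` a `Π_e`-set, gluings `S_e ≅ b^* S_v`; underlying
semi-graph `S.orbitGraph`, `OrbitGraph.lean`), with `Gal(S/𝒢) := Aut S`.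

PROOFS over the existing vocabulary; the only definitions are the base-point embedding
`CovObj.ptAut` / `CovObj.ptHom x : Π_v →* Aut S` (`σ · x = h⁻¹ · x`) and the branch `CovObj.brOf` of
`S.orbitGraph` over `b` through a point of `S_v`. For `S` connected (`hconn`) with point-transitive
endomorphisms (`htrans`, e.g. Galois):
* rigidity and transitivity: `Aut S` acts simply transitively on every fibre `S_v`
  (`CovObj.exists_aut_fV_eq`, `CovObj.aut_eq_of_fV_eq`);
* `ptHom x h = 1 ↔ h · x = x` and the kernel of `ptHom x` is open;
* (DV at one level) the vertex-orbit of `τ · x` has `Aut S`-stabiliser `τ · ptHom x (Π_v) · τ⁻¹`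
  (`CovObj.oVertexMap_mk_eq_iff`, `CovObj.stab_oVertex_iff`);
* (DB/DI at one level) the branches of `S.orbitGraph` over `b ∋ v` are the `brOf b (σ · x)`, the branch
  `brOf b (σ · x)` abuts to the orbit of `σ · x`, `q · brOf b (σ · x) = brOf b ((q σ) · x)`, two such branches
  agree iff `σ⁻¹ σ' ∈ ptHom x (Π_b)`, and the stabiliser of `brOf b ((τ · ptHom x y) · x)` is
  `τ · ptHom x (y Π_b y⁻¹) · τ⁻¹`.
Nothing here takes a side on [IUTchIII] Cor. 3.12.
-/

namespace Literature.AnabelianGeometry.SemiGraphs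

namespace ProfiniteSemiGraph

open CategoryTheory Topology
open Literature.AlgebraicGeometry.Frobenioids.QuasiTemperoid.BTempConnected (ρ_one_apply
  ρ_mul_apply ρ_inv_apply ρ_apply_inv)

universe u

variable {𝒢 : ProfiniteSemiGraph.{u}} (S : CovObj 𝒢)
  (hconn : ∀ p q : S.Point, S.SameComponent p q)
  (htrans : ∀ (v : 𝒢.graph.Vertex) (x x' : (S.SV v).obj.V), ∃ σ : S ⟶ S, (σ.fV v).hom.hom x = x')

/-! ### Rigidity and transitivity: the fibres are `Aut S`-torsors -/

section Torsor

include hconn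

/-- **Rigidity**: two morphisms out of a connected covering agreeing at one point of a vertex fibre are
equal. [cite: MochizukiSemiAnbd2006, Def. 2.2(i) p.23] -/
theorem CovObj.hom_eq_of_fV_apply_eq {T : CovObj 𝒢} (φ ψ : S ⟶ T) {v : 𝒢.graph.Vertex}
    (x : (S.SV v).obj.V) (h : (φ.fV v).hom.hom x = (ψ.fV v).hom.hom x) : φ = ψ :=
  CovHom.ext_of_sameComponent φ ψ (Sum.inl ⟨v, x⟩) (hconn _) (by
    change (Sum.inl ⟨v, (φ.fV v).hom.hom x⟩ : T.Point) = Sum.inl ⟨v, (ψ.fV v).hom.hom x⟩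
    rw [h])

/-- Rigidity for automorphisms. [cite: MochizukiSemiAnbd2006, Def. 2.2(i) p.23] -/
theorem CovObj.aut_eq_of_fV_eq {σ τ : Aut S} {v : 𝒢.graph.Vertex} (x : (S.SV v).obj.V)
    (h : (σ.hom.fV v).hom.hom x = (τ.hom.fV v).hom.hom x) : σ = τ :=
  Iso.ext (S.hom_eq_of_fV_apply_eq hconn σ.hom τ.hom x h)

include htrans

/-- **Transitivity**: for a connected covering with point-transitive endomorphisms (e.g. Galois), the
automorphism group acts transitively on every vertex fibre (an endomorphism moving `x` to `x'` and one
moving `x'` to `x` are mutually inverse by rigidity). [cite: MochizukiSemiAnbd2006, Def. 2.2(i) p.23] -/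
theorem CovObj.exists_aut_fV_eq {v : 𝒢.graph.Vertex} (x x' : (S.SV v).obj.V) :
    ∃ σ : Aut S, (σ.hom.fV v).hom.hom x = x' := by
  obtain ⟨η₁, h₁⟩ := htrans v x x'
  obtain ⟨η₂, h₂⟩ := htrans v x' x
  refine ⟨⟨η₁, η₂, ?_, ?_⟩, h₁⟩
  · refine S.hom_eq_of_fV_apply_eq hconn _ _ x ?_
    change (η₂.fV v).hom.hom ((η₁.fV v).hom.hom x) = x
    rw [h₁, h₂]
  · refine S.hom_eq_of_fV_apply_eq hconn _ _ x' ?_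
    change (η₁.fV v).hom.hom ((η₂.fV v).hom.hom x') = x'
    rw [h₂, h₁]

end Torsor

/-! ### The base-point embedding `Π_v → Aut S` -/

section PtHom

variable {v : 𝒢.graph.Vertex} (x : (S.SV v).obj.V)

include hconn htrans in
/-- Existence of the automorphism moving `x` to `h⁻¹ · x`. [cite: MochizukiSemiAnbd2006, Rmk. 2.2.1 p.24] -/
theorem CovObj.exists_ptAut (h : 𝒢.Gv v) :
    ∃ σ : Aut S, (σ.hom.fV v).hom.hom x = (S.SV v).obj.ρ h⁻¹ x :=
  S.exists_aut_fV_eq hconn htrans x _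

/-- The automorphism `ptAut x h` of the Galois covering `S` moving the base point `x ∈ S_v` to `h⁻¹ · x`
(`h ∈ Π_v`). [cite: MochizukiSemiAnbd2006, Rmk. 2.2.1 p.24] -/
noncomputable def CovObj.ptAut (h : 𝒢.Gv v) : Aut S :=
  (S.exists_ptAut hconn htrans x h).choose

/-- Defining property of `ptAut`. [cite: MochizukiSemiAnbd2006, Rmk. 2.2.1 p.24] -/
theorem CovObj.ptAut_apply (h : 𝒢.Gv v) :
    ((S.ptAut hconn htrans x h).hom.fV v).hom.hom x = (S.SV v).obj.ρ h⁻¹ x :=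
  (S.exists_ptAut hconn htrans x h).choose_spec

/-- **The base-point embedding `ψ_x : Π_v →* Gal(S/𝒢) = Aut S`**, `ψ_x(h) · x = h⁻¹ · x` (a homomorphism
because automorphisms commute with the `Π_v`-action). Its image is the decomposition group of the
vertex-orbit of `x` (Remark 2.2.1). [cite: MochizukiSemiAnbd2006, Rmk. 2.2.1 p.24] -/
noncomputable def CovObj.ptHom : 𝒢.Gv v →* Aut S where
  toFun := S.ptAut hconn htrans x
  map_one' := S.aut_eq_of_fV_eq hconn x (by
    rw [S.ptAut_apply hconn htrans x 1, inv_one, ρ_one_apply]; rfl)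
  map_mul' h₁ h₂ := S.aut_eq_of_fV_eq hconn x (by
    rw [S.ptAut_apply hconn htrans x (h₁ * h₂), mul_inv_rev, ρ_mul_apply]
    change _ = ((S.ptAut hconn htrans x h₁).hom.fV v).hom.hom
      (((S.ptAut hconn htrans x h₂).hom.fV v).hom.hom x)
    rw [S.ptAut_apply hconn htrans x h₂, CovHom.fV_ρ, S.ptAut_apply hconn htrans x h₁])

/-- `ψ_x(h) · x = h⁻¹ · x`. [cite: MochizukiSemiAnbd2006, Rmk. 2.2.1 p.24] -/
theorem CovObj.ptHom_apply (h : 𝒢.Gv v) :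
    ((S.ptHom hconn htrans x h).hom.fV v).hom.hom x = (S.SV v).obj.ρ h⁻¹ x :=
  S.ptAut_apply hconn htrans x h

/-- `ψ_x(h⁻¹) · x = h · x`. [cite: MochizukiSemiAnbd2006, Rmk. 2.2.1 p.24] -/
theorem CovObj.ptHom_inv_apply (h : 𝒢.Gv v) :
    ((S.ptHom hconn htrans x h⁻¹).hom.fV v).hom.hom x = (S.SV v).obj.ρ h x := by
  rw [S.ptHom_apply hconn htrans x h⁻¹, inv_inv]

/-- `ψ_x(h) = 1 ↔ h · x = x`: the kernel of the base-point embedding is the stabiliser of the base point.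
[cite: MochizukiSemiAnbd2006, Rmk. 2.2.1 p.24] -/
theorem CovObj.ptHom_eq_one_iff (h : 𝒢.Gv v) :
    S.ptHom hconn htrans x h = 1 ↔ (S.SV v).obj.ρ h x = x := by
  constructor
  · intro h1
    have h2 := S.ptHom_apply hconn htrans x h
    rw [h1] at h2
    change x = (S.SV v).obj.ρ h⁻¹ x at h2
    have h3 := congrArg ((S.SV v).obj.ρ h) h2
    rw [ρ_apply_inv] at h3
    exact h3
  · intro h1
    refine S.aut_eq_of_fV_eq hconn x ?_
    rw [S.ptHom_apply hconn htrans x h]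
    change (S.SV v).obj.ρ h⁻¹ x = x
    conv_lhs => rw [← h1]
    rw [ρ_inv_apply]

/-- The kernel of `ψ_x` is open in `Π_v` (the action on `S_v` is continuous).
[cite: MochizukiSemiAnbd2006, Rmk. 2.2.1 p.24] -/
theorem CovObj.isOpen_ker_ptHom : IsOpen ((S.ptHom hconn htrans x).ker : Set (𝒢.Gv v)) := by
  have : ((S.ptHom hconn htrans x).ker : Set (𝒢.Gv v)) = {h | (S.SV v).obj.ρ h x = x} := by
    ext h
    rw [SetLike.mem_coe, MonoidHom.mem_ker, S.ptHom_eq_one_iff hconn htrans x h]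
    rfl
  rw [this]
  exact (S.SV v).property.2 x

/-- The fibres of `ψ_x` are open (cosets of the open kernel). [cite: MochizukiSemiAnbd2006, Rmk. 2.2.1 p.24] -/
theorem CovObj.isOpen_ptHom_preimage (σ : Aut S) : IsOpen (S.ptHom hconn htrans x ⁻¹' {σ}) := by
  by_cases hσ : ∃ h₀, S.ptHom hconn htrans x h₀ = σ
  · obtain ⟨h₀, rfl⟩ := hσ
    have : S.ptHom hconn htrans x ⁻¹' {S.ptHom hconn htrans x h₀} =
        (fun h => h₀⁻¹ * h) ⁻¹' ((S.ptHom hconn htrans x).ker : Set (𝒢.Gv v)) := by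
      ext h
      simp only [Set.mem_preimage, Set.mem_singleton_iff, SetLike.mem_coe, MonoidHom.mem_ker, map_mul,
        map_inv]
      rw [inv_mul_eq_one]
      exact ⟨fun e => e.symm, fun e => e.symm⟩
    rw [this]
    exact (S.isOpen_ker_ptHom hconn htrans x).preimage (continuous_const.mul continuous_id)
  · have : S.ptHom hconn htrans x ⁻¹' {σ} = ∅ := by
      ext h
      simp only [Set.mem_preimage, Set.mem_singleton_iff, Set.mem_empty_iff_false, iff_false]
      exact fun hh => hσ ⟨h, hh⟩
    rw [this]
    exact isOpen_empty

end PtHom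

/-! ### Vertices over `v` = cosets of `ψ_x(Π_v)`; vertex stabilisers (DV at one level) -/

section Vertices

variable {v : 𝒢.graph.Vertex} (x : (S.SV v).obj.V)

/-- The induced map on vertex-orbits, on representatives. [cite: MochizukiSemiAnbd2006, Def. 2.2(i) p.23] -/
theorem CovObj.oVertexMap_mk {T : CovObj 𝒢} (f : S ⟶ T) {w : 𝒢.graph.Vertex} (y : (S.SV w).obj.V) :
    CovObj.OVertex.map f (Quot.mk S.VRel ⟨w, y⟩) = Quot.mk T.VRel ⟨w, (f.fV w).hom.hom y⟩ := rfl

include hconn htrans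

/-- **Vertices over `v` ↔ cosets** (Definition 2.2 (i)): the orbits of `σ · x` and `τ · x` agree iff
`τ⁻¹ σ ∈ ψ_x(Π_v)`. [cite: MochizukiSemiAnbd2006, Def. 2.2(i) p.23] -/
theorem CovObj.mk_aut_eq_mk_aut_iff (σ τ : Aut S) :
    (Quot.mk S.VRel ⟨v, (σ.hom.fV v).hom.hom x⟩ : S.OVertex) = Quot.mk S.VRel ⟨v, (τ.hom.fV v).hom.hom x⟩ ↔
      τ⁻¹ * σ ∈ (S.ptHom hconn htrans x).range := by
  constructor
  · intro h
    obtain ⟨g, hg⟩ := S.exists_ρ_of_mk_eq_mk h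
    -- `σ · x = g⁻¹ · (τ · x) = τ · (g⁻¹ · x) = (τ ψ(g)) · x`
    refine ⟨g, ?_⟩
    rw [eq_inv_mul_iff_mul_eq]
    refine S.aut_eq_of_fV_eq hconn x ?_
    change ((τ.hom.fV v).hom.hom (((S.ptHom hconn htrans x g).hom.fV v).hom.hom x)) = _
    rw [S.ptHom_apply hconn htrans x g, CovHom.fV_ρ, ← hg, ρ_inv_apply]
  · rintro ⟨g, hg⟩
    rw [eq_inv_mul_iff_mul_eq] at hg
    have h1 : (σ.hom.fV v).hom.hom x = (S.SV v).obj.ρ g⁻¹ ((τ.hom.fV v).hom.hom x) := by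
      rw [← hg]
      change ((τ.hom.fV v).hom.hom (((S.ptHom hconn htrans x g).hom.fV v).hom.hom x)) = _
      rw [S.ptHom_apply hconn htrans x g, CovHom.fV_ρ]
    rw [h1]
    exact (Quot.sound (CovObj.VRel.mk v g⁻¹ _)).symm

/-- **Vertex stabilisers (Remark 2.2.1 at one level)**: `q` fixes the vertex-orbit of `τ · x` iff
`q ∈ τ ψ_x(Π_v) τ⁻¹`. [cite: MochizukiSemiAnbd2006, Rmk. 2.2.1 p.24] -/
theorem CovObj.stab_oVertex_iff (τ q : Aut S) :
    CovObj.OVertex.map q.hom (Quot.mk S.VRel ⟨v, (τ.hom.fV v).hom.hom x⟩) =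
        Quot.mk S.VRel ⟨v, (τ.hom.fV v).hom.hom x⟩ ↔
      q ∈ (S.ptHom hconn htrans x).range.map (MulAut.conj τ).toMonoidHom := by
  change (Quot.mk S.VRel ⟨v, ((q * τ).hom.fV v).hom.hom x⟩ : S.OVertex) =
      Quot.mk S.VRel ⟨v, (τ.hom.fV v).hom.hom x⟩ ↔ _
  rw [S.mk_aut_eq_mk_aut_iff hconn htrans x]
  constructor
  · intro h
    refine ⟨τ⁻¹ * (q * τ), h, ?_⟩
    simp only [MulEquiv.coe_toMonoidHom, MulAut.conj_apply]
    group
  · rintro ⟨a, ha, rfl⟩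
    simp only [MulEquiv.coe_toMonoidHom, MulAut.conj_apply]
    have : τ⁻¹ * (τ * a * τ⁻¹ * τ) = a := by group
    rw [this]
    exact ha

end Vertices

/-! ### Branches over `b` = cosets of `ψ_x(Π_b)`; branch stabilisers (DB, DI at one level) -/

section Branches

variable (b : 𝒢.graph.Branch) {v : 𝒢.graph.Vertex} (hb : 𝒢.graph.abuts b = some v)

/-- The branch of `S.orbitGraph` over `b` "through" the point `y ∈ S_v` (`b` abutting to `v`): the branch
over `b` of the edge-orbit of `glue_b⁻¹ y ∈ S_{e(b)}`. [cite: MochizukiSemiAnbd2006, Def. 2.2(i) p.23] -/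
noncomputable def CovObj.brOf (y : (S.SV v).obj.V) : S.orbitGraph.Branch :=
  ⟨(b, Quot.mk S.ERel ⟨𝒢.graph.edgeOf b, (S.glue b v hb).inv.hom.hom y⟩), rfl⟩

/-- `brOf b y` lies over `b`. [cite: MochizukiSemiAnbd2006, Def. 2.2(i) p.23] -/
theorem CovObj.orbitGraphProj_branchMap_brOf (y : (S.SV v).obj.V) :
    S.orbitGraphProj.branchMap (S.brOf b hb y) = b := rfl

/-- `brOf b y` abuts to the vertex-orbit of `y`. [cite: MochizukiSemiAnbd2006, Def. 2.2(i) p.23] -/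
theorem CovObj.abuts_brOf (y : (S.SV v).obj.V) :
    S.orbitGraph.abuts (S.brOf b hb y) = some (Quot.mk S.VRel ⟨v, y⟩) := by
  change S.orbitGraph.abuts ⟨(b, _), _⟩ = _
  rw [S.orbitGraph_abuts_of_abuts b _ rfl v hb, S.glueOpt_mk, S.glue_hom_inv]

/-- Every branch of `S.orbitGraph` over `b` is a `brOf b y`. [cite: MochizukiSemiAnbd2006, Def. 2.2(i) p.23] -/
theorem CovObj.exists_eq_brOf (β : S.orbitGraph.Branch) (hβ : S.orbitGraphProj.branchMap β = b) :
    ∃ y : (S.SV v).obj.V, β = S.brOf b hb y := by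
  obtain ⟨⟨b', E⟩, hE⟩ := β
  change b' = b at hβ
  subst hβ
  induction E using Quot.ind with
  | mk p =>
    obtain ⟨e, z⟩ := p
    change e = 𝒢.graph.edgeOf b' at hE
    subst hE
    refine ⟨(S.glue b' v hb).hom.hom.hom z, Subtype.ext (Prod.ext rfl ?_)⟩
    change (Quot.mk S.ERel ⟨𝒢.graph.edgeOf b', z⟩ : S.OEdge) =
      Quot.mk S.ERel ⟨𝒢.graph.edgeOf b', (S.glue b' v hb).inv.hom.hom ((S.glue b' v hb).hom.hom.hom z)⟩
    rw [S.glue_inv_hom]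

/-- The action of `Aut S` on branches: `q · brOf b y = brOf b (q · y)`.
[cite: MochizukiSemiAnbd2006, Def. 2.2(i) p.23] -/
theorem CovObj.branchMap_brOf (q : Aut S) (y : (S.SV v).obj.V) :
    (CovObj.orbitGraphMap q.hom).branchMap (S.brOf b hb y) = S.brOf b hb ((q.hom.fV v).hom.hom y) := by
  refine Subtype.ext (Prod.ext rfl ?_)
  change Quot.mk S.ERel ⟨𝒢.graph.edgeOf b, (q.hom.fE _).hom.hom ((S.glue b v hb).inv.hom.hom y)⟩ =
    Quot.mk S.ERel ⟨𝒢.graph.edgeOf b, (S.glue b v hb).inv.hom.hom ((q.hom.fV v).hom.hom y)⟩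
  congr 2
  apply Function.LeftInverse.injective (S.glue_inv_hom b v hb)
  rw [CovHom.glue_fE, S.glue_hom_inv, S.glue_hom_inv]

/-- Two branches `brOf b y`, `brOf b y'` agree iff `y' = k · y` for some `k ∈ Π_b` (`Π_b ⊆ Π_v` the image of
the edge group along `b`). [cite: MochizukiSemiAnbd2006, Def. 2.2(i) p.23] -/
theorem CovObj.brOf_eq_brOf_iff (y y' : (S.SV v).obj.V) :
    S.brOf b hb y = S.brOf b hb y' ↔ ∃ k ∈ 𝒢.branchSubgroup b v hb, (S.SV v).obj.ρ k y = y' := by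
  constructor
  · intro h
    have h1 : (Quot.mk S.ERel ⟨𝒢.graph.edgeOf b, (S.glue b v hb).inv.hom.hom y⟩ : S.OEdge) =
        Quot.mk S.ERel ⟨𝒢.graph.edgeOf b, (S.glue b v hb).inv.hom.hom y'⟩ :=
      congrArg (fun β : S.orbitGraph.Branch => β.1.2) h
    obtain ⟨g, hg⟩ := S.exists_ρE_of_mk_eq_mk h1
    refine ⟨𝒢.brHom b v hb g, ⟨g, rfl⟩, ?_⟩
    have h2 := congrArg (S.glue b v hb).hom.hom.hom hg
    rw [S.glue_ρ, S.glue_hom_inv, S.glue_hom_inv] at h2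
    exact h2
  · rintro ⟨k, ⟨g, rfl⟩, rfl⟩
    refine Subtype.ext (Prod.ext rfl ?_)
    change (Quot.mk S.ERel ⟨𝒢.graph.edgeOf b, (S.glue b v hb).inv.hom.hom y⟩ : S.OEdge) =
      Quot.mk S.ERel ⟨𝒢.graph.edgeOf b, (S.glue b v hb).inv.hom.hom
        ((S.SV v).obj.ρ ((𝒢.brHom b v hb).toMonoidHom g) y)⟩
    have h3 : (S.glue b v hb).inv.hom.hom ((S.SV v).obj.ρ ((𝒢.brHom b v hb).toMonoidHom g) y) =
        (S.SE (𝒢.graph.edgeOf b)).obj.ρ g ((S.glue b v hb).inv.hom.hom y) := by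
      apply Function.LeftInverse.injective (S.glue_inv_hom b v hb)
      rw [S.glue_hom_inv, S.glue_ρ, S.glue_hom_inv]
      rfl
    rw [h3]
    exact Quot.sound (CovObj.ERel.mk _ g _)

variable {b hb} (x : (S.SV v).obj.V)

include hconn htrans

/-- **Branches over `b` ↔ cosets of `ψ_x(Π_b)`** (Definition 2.2 (i) at one level): `brOf b (σ · x) =
brOf b (σ' · x)` iff `σ⁻¹ σ' ∈ ψ_x(Π_b)`. [cite: MochizukiSemiAnbd2006, Def. 2.2(i) p.23] -/
theorem CovObj.brOf_aut_eq_iff (σ σ' : Aut S) :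
    S.brOf b hb ((σ.hom.fV v).hom.hom x) = S.brOf b hb ((σ'.hom.fV v).hom.hom x) ↔
      σ⁻¹ * σ' ∈ (𝒢.branchSubgroup b v hb).map (S.ptHom hconn htrans x) := by
  rw [S.brOf_eq_brOf_iff]
  constructor
  · rintro ⟨k, hk, hkx⟩
    -- `k · (σ · x) = σ · (k · x) = (σ ψ(k⁻¹)) · x`
    refine ⟨k⁻¹, (𝒢.branchSubgroup b v hb).inv_mem hk, ?_⟩
    rw [eq_inv_mul_iff_mul_eq]
    refine S.aut_eq_of_fV_eq hconn x ?_
    change (σ.hom.fV v).hom.hom (((S.ptHom hconn htrans x k⁻¹).hom.fV v).hom.hom x) = _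
    rw [S.ptHom_inv_apply hconn htrans x k, CovHom.fV_ρ, hkx]
  · rintro ⟨k, hk, hkσ⟩
    rw [eq_inv_mul_iff_mul_eq] at hkσ
    refine ⟨k⁻¹, (𝒢.branchSubgroup b v hb).inv_mem hk, ?_⟩
    rw [← hkσ]
    change _ = (σ.hom.fV v).hom.hom (((S.ptHom hconn htrans x k).hom.fV v).hom.hom x)
    rw [S.ptHom_apply hconn htrans x k, CovHom.fV_ρ]

/-- **Branch stabilisers (Remark 2.2.1 at one level)**: `q` fixes `brOf b (σ · x)` iff
`q ∈ σ ψ_x(Π_b) σ⁻¹`. [cite: MochizukiSemiAnbd2006, Rmk. 2.2.1 p.24] -/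
theorem CovObj.stab_brOf_iff (σ q : Aut S) :
    (CovObj.orbitGraphMap q.hom).branchMap (S.brOf b hb ((σ.hom.fV v).hom.hom x)) =
        S.brOf b hb ((σ.hom.fV v).hom.hom x) ↔
      q ∈ ((𝒢.branchSubgroup b v hb).map (S.ptHom hconn htrans x)).map (MulAut.conj σ).toMonoidHom := by
  rw [S.branchMap_brOf]
  have h1 : (q.hom.fV v).hom.hom ((σ.hom.fV v).hom.hom x) = ((q * σ).hom.fV v).hom.hom x := rfl
  rw [h1, eq_comm, S.brOf_aut_eq_iff hconn htrans x]
  constructor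
  · intro h
    refine ⟨σ⁻¹ * (q * σ), h, ?_⟩
    simp only [MulEquiv.coe_toMonoidHom, MulAut.conj_apply]
    group
  · rintro ⟨a, ha, rfl⟩
    simp only [MulEquiv.coe_toMonoidHom, MulAut.conj_apply]
    have : σ⁻¹ * (σ * a * σ⁻¹ * σ) = a := by group
    rw [this]
    exact ha

/-- Branch stabilisers in the shape of the dictionary obligation (DB): the stabiliser of
`brOf b ((τ ψ_x(y)) · x)` is `τ · ψ_x(y Π_b y⁻¹) · τ⁻¹`. [cite: MochizukiSemiAnbd2006, Rmk. 2.2.1 p.24] -/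
theorem CovObj.stab_brOf_iff' (τ q : Aut S) (y : 𝒢.Gv v) :
    (CovObj.orbitGraphMap q.hom).branchMap
          (S.brOf b hb (((τ * S.ptHom hconn htrans x y).hom.fV v).hom.hom x)) =
        S.brOf b hb (((τ * S.ptHom hconn htrans x y).hom.fV v).hom.hom x) ↔
      q ∈ (((𝒢.branchSubgroup b v hb).map (MulAut.conj y).toMonoidHom).map
        (S.ptHom hconn htrans x)).map (MulAut.conj τ).toMonoidHom := by
  rw [S.stab_brOf_iff hconn htrans x]
  have : ((𝒢.branchSubgroup b v hb).map (S.ptHom hconn htrans x)).map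
      (MulAut.conj (τ * S.ptHom hconn htrans x y)).toMonoidHom =
      (((𝒢.branchSubgroup b v hb).map (MulAut.conj y).toMonoidHom).map
        (S.ptHom hconn htrans x)).map (MulAut.conj τ).toMonoidHom := by
    ext q
    simp only [Subgroup.mem_map, MulEquiv.coe_toMonoidHom, MulAut.conj_apply]
    constructor
    · rintro ⟨a, ⟨k, hk, rfl⟩, rfl⟩
      refine ⟨S.ptHom hconn htrans x (y * k * y⁻¹), ⟨y * k * y⁻¹, ⟨k, hk, rfl⟩, rfl⟩, ?_⟩
      simp only [map_mul, map_inv, mul_inv_rev, mul_assoc]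
    · rintro ⟨a, ⟨c, ⟨k, hk, rfl⟩, rfl⟩, rfl⟩
      refine ⟨S.ptHom hconn htrans x k, ⟨k, hk, rfl⟩, ?_⟩
      simp only [map_mul, map_inv, mul_inv_rev, mul_assoc]
  rw [this]

end Branches

end ProfiniteSemiGraph

end Literature.AnabelianGeometry.SemiGraphs
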